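import Mathlib
import Summits.Ventures.PercRepro2.K5Kron
import Summits.Ventures.PercRepro2.K5Digits
import Summits.Ventures.PercRepro2.K5Hyper

/-!
# THE BIT-TABLE KRONECKER NUMBERS ARE THE KRONECKER SUMS
(blind cell PercRepro2, typer-1 g10; the bridge file of `K5Hyper.lean`)

* `goGen_eq`: the generic edge-tree recursion `goGen leaf B w` (`goGen (n+1) ω = goGen n ω[n ↦ 0] +
  B^{w n} · goGen n ω[n ↦ 1]`) computes `Σ_s leaf s · B^{Σ_{e<n} s_e w_e}` over the configurations agreeing
  with `ω` on the edges `≥ n` (`K5Kron.go_eq` with the base and the edge weights abstract);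
* `bits_eq`: the bit table `bits T` is `Σ_ω [T ω] · 2^{idx2 ω}`, and **`testBit_bits`**: its bit `idx2 ω` is
  `T ω` (the digits of a base-`2` sum with digits `< 2`, `K5Digits.digit_sum`; `idx2` is a bijection onto
  `[0, 1024)`, `decode2_idx2` / `idx2_decode2`);
* **`kron3_eq`**: `kron3 T S = Σ_ω [T (ω ∨ S)] · KB3^{idx ω}` — the masked Kronecker number computed through
  the bit table is the Kronecker sum of the masked table; **`kron3_mul_mul`**: a product of three of them
  is `Σ_k cnt3 (T₁ ∘ orOn S₁) (T₂ ∘ orOn S₂) (T₃ ∘ orOn S₃) k · KB3^{idx4 k}` (`K5Kron.kronSum_mul_mul`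
  in base `KB3`).
-/

namespace Summit.Ventures.PercRepro2

open Hub

namespace K5

/-! ## The generic edge tree -/

section GenTree

/-- The weighted partial index: the states of the edges `< n` with the weights `w`. -/
def idxW (w : ℕ → ℕ) (n : ℕ) (ω : Fin 10 → Bool) : ℕ :=
  ∑ e ∈ Finset.univ.filter (fun e : Fin 10 => (e : ℕ) < n), (ω e).toNat * w (e : ℕ)

/-- `idxW (n+1)` splits off the edge `n`. -/
lemma idxW_succ (w : ℕ → ℕ) {n : ℕ} (hn : n < 10) (s : Fin 10 → Bool) :
    idxW w (n + 1) s = idxW w n s + (s (Fin.ofNat 10 n)).toNat * w n := by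
  unfold idxW
  have hset : (Finset.univ.filter fun e : Fin 10 => (e : ℕ) < n + 1) =
      insert (Fin.ofNat 10 n) (Finset.univ.filter fun e : Fin 10 => (e : ℕ) < n) := by
    ext e
    simp only [Finset.mem_filter, Finset.mem_univ, true_and, Finset.mem_insert]
    constructor
    · intro h
      rcases Nat.lt_succ_iff_lt_or_eq.1 h with h | h
      · exact Or.inr h
      · left; apply Fin.ext; rw [ofNat_val hn, h]
    · rintro (h | h)
      · rw [h, ofNat_val hn]; omega
      · omega
  rw [hset, Finset.sum_insert (by
    simp only [Finset.mem_filter, Finset.mem_univ, true_and, not_lt, ofNat_val hn, le_refl]),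
    ofNat_val hn, add_comm]

/-- The generic edge tree: base `B`, edge weights `w`, leaf values `leaf`. -/
def goGen (leaf : (Fin 10 → Bool) → ℕ) (B : ℕ) (w : ℕ → ℕ) : ℕ → (Fin 10 → Bool) → ℕ
  | 0, ω => leaf ω
  | n + 1, ω => goGen leaf B w n (Function.update ω (Fin.ofNat 10 n) false) +
      B ^ (w n) * goGen leaf B w n (Function.update ω (Fin.ofNat 10 n) true)

/-- **The invariant of the generic tree**: `goGen n ω` sums the leaves over the configurations agreeing
with `ω` on the edges `≥ n`, weighted by `B^{idxW w n}`. -/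
theorem goGen_eq (leaf : (Fin 10 → Bool) → ℕ) (B : ℕ) (w : ℕ → ℕ) :
    ∀ (n : ℕ), n ≤ 10 → ∀ ω : Fin 10 → Bool,
      goGen leaf B w n ω = ∑ s ∈ Finset.univ.filter (fun s => AgreeGe n ω s), leaf s * B ^ idxW w n s
  | 0, _, ω => by
    have hfil : (Finset.univ.filter fun s : Fin 10 → Bool => AgreeGe 0 ω s) = {ω} := by
      ext s
      simp only [Finset.mem_filter, Finset.mem_univ, true_and, Finset.mem_singleton, AgreeGe,
        Nat.zero_le, true_implies]
      exact ⟨fun h => funext h, fun h e => by rw [h]⟩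
    rw [hfil, Finset.sum_singleton]
    simp [goGen, idxW]
  | n + 1, hn, ω => by
    have hn' : n < 10 := by omega
    rw [goGen, goGen_eq leaf B w n (by omega), goGen_eq leaf B w n (by omega)]
    rw [← Finset.sum_filter_add_sum_filter_not (Finset.univ.filter fun s => AgreeGe (n + 1) ω s)
      (fun s : Fin 10 → Bool => s (Fin.ofNat 10 n) = true)]
    rw [Finset.filter_filter, Finset.filter_filter]
    have e0 : (Finset.univ.filter fun s : Fin 10 → Bool => AgreeGe (n + 1) ω s ∧
        ¬ s (Fin.ofNat 10 n) = true) =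
        Finset.univ.filter fun s => AgreeGe n (Function.update ω (Fin.ofNat 10 n) false) s := by
      ext s
      simp only [Finset.mem_filter, Finset.mem_univ, true_and, AgreeGe, Bool.not_eq_true]
      constructor
      · rintro ⟨h, hs⟩ e he
        by_cases hen : e = Fin.ofNat 10 n
        · rw [hen, Function.update_self, hs]
        · rw [Function.update_of_ne hen]
          refine h e ?_
          have : (e : ℕ) ≠ n := fun h' => hen (Fin.ext (by rw [ofNat_val hn', h']))
          omega
      · intro h
        refine ⟨fun e he => ?_, ?_⟩
        · have hen : e ≠ Fin.ofNat 10 n := fun h' => by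
            rw [h', ofNat_val hn'] at he; omega
          rw [← Function.update_of_ne hen false ω]
          exact h e (by omega)
        · have := h (Fin.ofNat 10 n) (by rw [ofNat_val hn'])
          rwa [Function.update_self] at this
    have e1 : (Finset.univ.filter fun s : Fin 10 → Bool => AgreeGe (n + 1) ω s ∧
        s (Fin.ofNat 10 n) = true) =
        Finset.univ.filter fun s => AgreeGe n (Function.update ω (Fin.ofNat 10 n) true) s := by
      ext s
      simp only [Finset.mem_filter, Finset.mem_univ, true_and, AgreeGe]
      constructor
      · rintro ⟨h, hs⟩ e he
        by_cases hen : e = Fin.ofNat 10 n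
        · rw [hen, Function.update_self, hs]
        · rw [Function.update_of_ne hen]
          refine h e ?_
          have : (e : ℕ) ≠ n := fun h' => hen (Fin.ext (by rw [ofNat_val hn', h']))
          omega
      · intro h
        refine ⟨fun e he => ?_, ?_⟩
        · have hen : e ≠ Fin.ofNat 10 n := fun h' => by
            rw [h', ofNat_val hn'] at he; omega
          rw [← Function.update_of_ne hen true ω]
          exact h e (by omega)
        · have := h (Fin.ofNat 10 n) (by rw [ofNat_val hn'])
          rwa [Function.update_self] at this
    rw [e0, e1, Finset.mul_sum, add_comm]
    congr 1
    · refine Finset.sum_congr rfl fun s hs => ?_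
      rw [Finset.mem_filter] at hs
      have hsn : s (Fin.ofNat 10 n) = true := by
        have := hs.2 (Fin.ofNat 10 n) (by rw [ofNat_val hn'])
        rwa [Function.update_self] at this
      rw [idxW_succ w hn', hsn, pow_add]
      simp only [Bool.toNat_true, one_mul]
      ring
    · refine Finset.sum_congr rfl fun s hs => ?_
      rw [Finset.mem_filter] at hs
      have hsn : s (Fin.ofNat 10 n) = false := by
        have := hs.2 (Fin.ofNat 10 n) (by rw [ofNat_val hn'])
        rwa [Function.update_self] at this
      rw [idxW_succ w hn', hsn]
      simp

/-- The weighted index over all ten edges. -/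
lemma idxW_ten (w : ℕ → ℕ) (s : Fin 10 → Bool) : idxW w 10 s = ∑ e, (s e).toNat * w (e : ℕ) := by
  unfold idxW
  apply Finset.sum_congr
  · ext e
    simp only [Finset.mem_filter, Finset.mem_univ, true_and, iff_true]
    exact e.isLt
  · intros; rfl

/-- **The generic tree over all ten edges is the finite sum.** -/
theorem goGen_ten (leaf : (Fin 10 → Bool) → ℕ) (B : ℕ) (w : ℕ → ℕ) :
    goGen leaf B w 10 (fun _ => false) = ∑ s, leaf s * B ^ (∑ e, (s e).toNat * w (e : ℕ)) := by
  rw [goGen_eq leaf B w 10 le_rfl]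
  have hfil : (Finset.univ.filter fun s : Fin 10 → Bool => AgreeGe 10 (fun _ => false) s) =
      Finset.univ := by
    ext s
    simp only [Finset.mem_filter, Finset.mem_univ, true_and, iff_true, AgreeGe]
    intro e he
    exact absurd he (by omega)
  rw [hfil]
  refine Finset.sum_congr rfl fun s _ => ?_
  rw [idxW_ten]

end GenTree

/-! ## The bit table -/

section Bits

/-- `goB` is the generic tree with base `2`, weights `2^e` and the leaves `[T s]`. -/
lemma goB_eq_goGen (T : (Fin 10 → Bool) → Bool) :
    ∀ (n : ℕ) (ω : Fin 10 → Bool), goB T n ω = goGen (fun s => (T s).toNat) 2 (fun e => 2 ^ e) n ω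
  | 0, ω => rfl
  | n + 1, ω => by
    rw [goB, goGen, goB_eq_goGen T n, goB_eq_goGen T n]

/-- The base-`2` index, as a sum over the edges. -/
lemma idx2_eq_sum (s : Fin 10 → Bool) : idx2 s = ∑ e, (s e).toNat * 2 ^ (e : ℕ) := by
  simp only [idx2, Fin.sum_univ_succ, Fin.sum_univ_zero]
  simp
  ring

/-- **The bit table is the base-`2` Kronecker sum.** -/
theorem bits_eq (T : (Fin 10 → Bool) → Bool) : bits T = ∑ s, (T s).toNat * 2 ^ idx2 s := by
  unfold bits
  rw [goB_eq_goGen, goGen_ten]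
  refine Finset.sum_congr rfl fun s _ => ?_
  rw [idx2_eq_sum]

/-- The base-`2` index is below `1024`. -/
lemma idx2_lt (s : Fin 10 → Bool) : idx2 s < 1024 := by
  unfold idx2
  have h0 := Bool.toNat_le (s 0)
  have h1 := Bool.toNat_le (s 1)
  have h2 := Bool.toNat_le (s 2)
  have h3 := Bool.toNat_le (s 3)
  have h4 := Bool.toNat_le (s 4)
  have h5 := Bool.toNat_le (s 5)
  have h6 := Bool.toNat_le (s 6)
  have h7 := Bool.toNat_le (s 7)
  have h8 := Bool.toNat_le (s 8)
  have h9 := Bool.toNat_le (s 9)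
  omega

/-- Decoding a base-`2` number into a configuration. -/
def decode2 (n : ℕ) : Fin 10 → Bool := fun e => decide (n / 2 ^ (e : ℕ) % 2 = 1)

set_option maxRecDepth 10000 in
/-- Decoding inverts the index. -/
lemma decode2_idx2 (s : Fin 10 → Bool) : decode2 (idx2 s) = s := by
  have h0 := Bool.toNat_le (s 0)
  have h1 := Bool.toNat_le (s 1)
  have h2 := Bool.toNat_le (s 2)
  have h3 := Bool.toNat_le (s 3)
  have h4 := Bool.toNat_le (s 4)
  have h5 := Bool.toNat_le (s 5)
  have h6 := Bool.toNat_le (s 6)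
  have h7 := Bool.toNat_le (s 7)
  have h8 := Bool.toNat_le (s 8)
  have h9 := Bool.toNat_le (s 9)
  funext e
  unfold decode2
  rw [Bool.eq_iff_iff, decide_eq_true_iff]
  fin_cases e
  · show idx2 s / 1 % 2 = 1 ↔ s 0 = true; unfold idx2; cases s 0 <;> simp <;> omega
  · show idx2 s / 2 % 2 = 1 ↔ s 1 = true; unfold idx2; cases s 1 <;> simp <;> omega
  · show idx2 s / 4 % 2 = 1 ↔ s 2 = true; unfold idx2; cases s 2 <;> simp <;> omega
  · show idx2 s / 8 % 2 = 1 ↔ s 3 = true; unfold idx2; cases s 3 <;> simp <;> omega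
  · show idx2 s / 16 % 2 = 1 ↔ s 4 = true; unfold idx2; cases s 4 <;> simp <;> omega
  · show idx2 s / 32 % 2 = 1 ↔ s 5 = true; unfold idx2; cases s 5 <;> simp <;> omega
  · show idx2 s / 64 % 2 = 1 ↔ s 6 = true; unfold idx2; cases s 6 <;> simp <;> omega
  · show idx2 s / 128 % 2 = 1 ↔ s 7 = true; unfold idx2; cases s 7 <;> simp <;> omega
  · show idx2 s / 256 % 2 = 1 ↔ s 8 = true; unfold idx2; cases s 8 <;> simp <;> omega
  · show idx2 s / 512 % 2 = 1 ↔ s 9 = true; unfold idx2; cases s 9 <;> simp <;> omega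

/-- The index of a decoded number below `1024` is the number (`K5Digits.expand_digits` in base `2`). -/
lemma idx2_decode2 {n : ℕ} (hn : n < 1024) : idx2 (decode2 n) = n := by
  rw [idx2_eq_sum]
  have h : ∀ e : Fin 10, ((decode2 n e).toNat : ℕ) * 2 ^ (e : ℕ) = n / 2 ^ (e : ℕ) % 2 * 2 ^ (e : ℕ) := by
    intro e
    unfold decode2
    rcases Nat.mod_two_eq_zero_or_one (n / 2 ^ (e : ℕ)) with h | h <;> rw [h] <;> simp
  simp only [h]
  rw [Fin.sum_univ_eq_sum_range (fun j => n / 2 ^ j % 2 * 2 ^ j) 10]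
  exact (expand_digits (B := 2) le_rfl 10 n (by norm_num; exact hn)).symm

/-- A sum over the configurations re-indexed over `range 1024` through `decode2`. -/
lemma sum_configs_eq (c : (Fin 10 → Bool) → ℕ) :
    ∑ s, c s * 2 ^ idx2 s = ∑ j ∈ Finset.range 1024, c (decode2 j) * 2 ^ j := by
  refine Finset.sum_nbij' idx2 decode2 (fun s _ => ?_) (fun j _ => Finset.mem_univ _)
    (fun s _ => decode2_idx2 s) (fun j hj => ?_) (fun s _ => ?_)
  · exact Finset.mem_range.2 (idx2_lt s)
  · exact idx2_decode2 (Finset.mem_range.1 hj)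
  · rw [decode2_idx2]

/-- **The bit `idx2 s` of the bit table is `T s`.** -/
theorem testBit_bits (T : (Fin 10 → Bool) → Bool) (s : Fin 10 → Bool) :
    (bits T).testBit (idx2 s) = T s := by
  rw [Nat.testBit_eq_decide_div_mod_eq, bits_eq, sum_configs_eq]
  rw [digit_sum (B := 2) le_rfl (fun j => (T (decode2 j)).toNat) 1024
    (fun j _ => by cases T (decode2 j) <;> simp) (idx2 s) (idx2_lt s), decode2_idx2]
  cases T s <;> simp

end Bits

/-! ## The masked Kronecker numbers -/

section Masked

/-- `go3b` is the generic tree with base `KB3`, weights `4^e` and the bit-read leaves. -/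
lemma go3b_eq_goGen (B : ℕ) (S : Fin 10 → Bool) :
    ∀ (n : ℕ) (ω : Fin 10 → Bool),
      go3b B S n ω = goGen (fun s => (B.testBit (idx2 (orOn S s))).toNat) KB3 (fun e => 4 ^ e) n ω
  | 0, ω => rfl
  | n + 1, ω => by
    rw [go3b, goGen, go3b_eq_goGen B S n, go3b_eq_goGen B S n]

/-- The Kronecker sum in base `KB3` of a table. -/
def kronSum3 (T : (Fin 10 → Bool) → Bool) : ℕ := ∑ ω, (T ω).toNat * KB3 ^ idx ω

/-- **The masked Kronecker number is the Kronecker sum of the masked table**: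
`kron3 T S = Σ_ω [T (ω ∨ S)] · KB3^{idx ω}`. -/
theorem kron3_eq (T : (Fin 10 → Bool) → Bool) (S : Fin 10 → Bool) :
    kron3 T S = kronSum3 (fun ω => T (orOn S ω)) := by
  unfold kron3 kronSum3
  rw [go3b_eq_goGen, goGen_ten]
  refine Finset.sum_congr rfl fun s _ => ?_
  rw [testBit_bits]
  rfl

set_option maxRecDepth 10000 in
set_option linter.constructorNameAsVariable false in
/-- A product of three Kronecker sums in base `KB3` as a triple sum. -/
lemma kronSum3_mul_mul_eq_sum (T₁ T₂ T₃ : (Fin 10 → Bool) → Bool) :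
    kronSum3 T₁ * kronSum3 T₂ * kronSum3 T₃ =
      ∑ t : (Fin 10 → Bool) × (Fin 10 → Bool) × (Fin 10 → Bool),
        (T₁ t.1).toNat * (T₂ t.2.1).toNat * (T₃ t.2.2).toNat * KB3 ^ idx4 (prof t.1 t.2.1 t.2.2) := by
  unfold kronSum3
  rw [sum_mul_sum_mul_sum_nat]
  simp only [Fintype.sum_prod_type]
  refine Finset.sum_congr rfl fun a _ => Finset.sum_congr rfl fun b _ =>
    Finset.sum_congr rfl fun c _ => ?_
  rw [idx4_prof, pow_add, pow_add]
  ring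

set_option maxRecDepth 10000 in
set_option linter.constructorNameAsVariable false in
/-- **Kronecker substitution in base `KB3`**: a product of three Kronecker sums is the encoding of the
triple counts. -/
theorem kronSum3_mul_mul (T₁ T₂ T₃ : (Fin 10 → Bool) → Bool) :
    kronSum3 T₁ * kronSum3 T₂ * kronSum3 T₃ = ∑ k, cnt3 T₁ T₂ T₃ k * KB3 ^ idx4 k := by
  rw [kronSum3_mul_mul_eq_sum]
  unfold cnt3
  simp only [Finset.sum_mul]
  rw [← Finset.sum_fiberwise Finset.univ
    (fun t : (Fin 10 → Bool) × (Fin 10 → Bool) × (Fin 10 → Bool) => prof t.1 t.2.1 t.2.2)]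
  refine Finset.sum_congr rfl fun k _ => Finset.sum_congr rfl fun t ht => ?_
  rw [Finset.mem_filter] at ht
  rw [ht.2]

/-- **A product of three masked Kronecker numbers is the encoding of the masked triple counts.** -/
theorem kron3_mul_mul (T₁ T₂ T₃ : (Fin 10 → Bool) → Bool) (S₁ S₂ S₃ : Fin 10 → Bool) :
    kron3 T₁ S₁ * kron3 T₂ S₂ * kron3 T₃ S₃ =
      ∑ k, cnt3 (fun ω => T₁ (orOn S₁ ω)) (fun ω => T₂ (orOn S₂ ω)) (fun ω => T₃ (orOn S₃ ω)) k *
        KB3 ^ idx4 k := by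
  rw [kron3_eq, kron3_eq, kron3_eq, kronSum3_mul_mul]

end Masked

end K5

end Summit.Ventures.PercRepro2
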